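import Literature.MathematicalPhysics.QuantumFieldTheory.Balaban1983to89.Beta.ColourTrace
import HarnessLib

/-!
# The Killing form of `𝔰𝔩(n, K)` and its semisimplicity [Humphreys1972, §5.1, §6 Ex. 7; Hall2015, Ex. 7.3]

statement-level skeleton of published theorems with citation tags; proofs where landed; nothing here is a claim about
the Yang–Mills mass gap (cell `lit-balaban` page-1 framing sentence — this is a classical support file of that cell, unit
`lit-balaban-p24`; sentence added in a docstring-only revision, referee N1 census gen 70; declarations byte-identical).

Topic `Algebra/Lie`.  Let `K` be a field and `n` a finite index type.  Mathlib's special linear Lie algebra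
`LieAlgebra.SpecialLinear.sl n K` (traceless `n × n` matrices, commutator bracket) is here shown to be

* a Lie **ideal** of `𝔤𝔩_n(K) = Matrix n n K` (`slIdeal`, `slIdealEquiv : slIdeal n K ≃ₗ⁅K⁆ sl n K`);
* of Killing form **`κ(X, Y) = 2·|n|·Tr(XY)`** (`killingForm_sl`) — Humphreys' Lemma of §5.1 («if `I` is an ideal of
  `L` then `κ_I = κ|_{I×I}`», Mathlib `LieIdeal.killingForm_eq`) applied to the value of the Killing form of `𝔤𝔩_n`,
  `2·|n|·Tr(XY) − 2·Tr X·Tr Y`, which the tree already holds as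
  `Literature.MathematicalPhysics.QuantumFieldTheory.Balaban1983to89.Beta.ColourTrace.killingForm_matrix` (imported,
  not restated; that module's header defers exactly this «subalgebra packaging»);
* **Killing** (non-degenerate Killing form, Mathlib `LieAlgebra.IsKilling`) as soon as `2·|n| ≠ 0` in `K`
  (`isKilling_sl`; the test matrices are the matrix units `E_{ji}`, `i ≠ j`, and `E_{ii} − E_{jj}`), in particular in
  characteristic zero (instance `instIsKillingSl`), hence **semisimple** (instance `instIsSemisimpleSl`, Mathlib
  `LieAlgebra.IsKilling.instSemisimple` = Humphreys' Theorem 5.1), with trivial radical and trivial centre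
  (`center_sl_eq_bot`) — Humphreys §4 Exercise 1 / Hall Example 7.3 «`𝔰𝔩(n; ℂ)` is semisimple»;
* and, for sharpness, NOT Killing when the characteristic divides `|n| ≠ 0` (`not_isKilling_sl_of_natCast_card_eq_zero`:
  then `1 ∈ 𝔰𝔩_n` is central — Humphreys §2 Exercise 3).

Mathlib (this pin) has `sl`, `killingForm`, `LieAlgebra.IsKilling` and Cartan's criteria but no instance of
`IsKilling`/`IsSemisimple` for `sl n K` (searched: the only `IsKilling` instances are
`HasTrivialRadical.instIsKilling`, `LieDerivation.instIsKilling_range_ad` and the Geck construction).  The commutator Lie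
ring structure on `Matrix n n K` is Mathlib's LOCAL instance `LieRing.ofAssociativeRing` (as in
`Mathlib.Algebra.Lie.Classical`), enabled for this file.

Consumers (why this is in the tree): the Bałaban lattice-gauge-theory cell's theorems quantify over an abstract
finite-dimensional semisimple `𝔤` (`[LieAlgebra.IsSemisimple ℂ 𝔥]` in `…Balaban1983to89.B10Eq32SuN` §3,
`…B13DerivZeroGauge` §3b, `…B12Ward414.decay510_window_semisimple_190`), whose printed instance is `𝔤ᶜ = 𝔰𝔩(N, ℂ)` for
`G = SU(N)`; `B10Eq32SuN` records «semisimplicity of 𝔰𝔩_N, N ≥ 2, which is not available in Mathlib and not proved here».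

## References

* [Humphreys1972] J. E. Humphreys, *Introduction to Lie Algebras and Representation Theory*, GTM 9 (1972): §2 Exercise 3
  (centre of `𝔰𝔩(n, F)`: `0` unless `char F ∣ n`), §4 Exercise 1
  («𝔰𝔩(n, F) is semisimple»), §5.1 Lemma (`κ_I = κ|_{I×I}`) and Theorem 5.1 (semisimple iff Killing form
  nondegenerate), §6 Exercise 7 («the Killing form κ on 𝔰𝔩(n, F) is related to the ordinary trace form by
  κ(x, y) = 2n Tr(xy)»).
* [Hall2015] B. C. Hall, *Lie Groups, Lie Algebras, and Representations*, 2nd ed., GTM 222 (2015), §7.1 Example 7.3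
  (the centre of `𝔰𝔩(n; ℂ)` is trivial, computed with `E_{jk}` and `H_{jk} = E_{jj} − E_{kk}`).
-/

-- Mathlib idiom (`Mathlib.Algebra.Lie.Classical`, `….Lie.OfAssociative`): the commutator bracket on an associative ring is
-- the NON-instance `LieRing.ofAssociativeRing`; enabled file-locally, exactly as where `LieAlgebra.SpecialLinear.sl` is
-- defined.  It overrides nothing (there is no global `LieRing (Matrix n n K)`).
attribute [local instance 100] LieRing.ofAssociativeRing

namespace Literature.Algebra.Lie.SpecialLinearKilling

open LieAlgebra LieAlgebra.SpecialLinear Matrix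
open Literature.MathematicalPhysics.QuantumFieldTheory.Balaban1983to89.Beta.ColourTrace (killingForm_matrix)

variable (n : Type*) [Fintype n] [DecidableEq n] (K : Type*)

/-! ### `𝔰𝔩_n` is an ideal of `𝔤𝔩_n` -/

section CommRing

variable [CommRing K]

/-- The traceless matrices as a Lie IDEAL of `𝔤𝔩_n(K)`: `Tr ⁅X, Y⁆ = 0` for all `X, Y` (so `⁅𝔤𝔩_n, 𝔤𝔩_n⁆ ⊆ 𝔰𝔩_n`).
Same carrier as Mathlib's Lie subalgebra `LieAlgebra.SpecialLinear.sl n K`. [cite: Humphreys1972, §5.1 Lemma] -/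
def slIdeal : LieIdeal K (Matrix n n K) :=
  { LinearMap.ker (Matrix.traceLinearMap n K K) with
    lie_mem := fun {X Y} _ => LinearMap.mem_ker.2 (LieAlgebra.matrix_trace_commutator_zero n K X Y) }

variable {n K} in
/-- Membership in `slIdeal`: `Tr X = 0`. [cite: Humphreys1972, §1.2] -/
@[simp] theorem mem_slIdeal_iff {X : Matrix n n K} : X ∈ slIdeal n K ↔ X.trace = 0 := Iff.rfl

variable {n K} in
/-- Membership in Mathlib's `sl n K`: `Tr X = 0`. [cite: Humphreys1972, §1.2] -/
@[simp] theorem mem_sl_iff {X : Matrix n n K} : X ∈ sl n K ↔ X.trace = 0 := Iff.rfl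

/-- As a Lie subalgebra, `slIdeal n K` is Mathlib's `sl n K`. [cite: Humphreys1972, §1.2] -/
theorem slIdeal_toLieSubalgebra : ((slIdeal n K : LieIdeal K (Matrix n n K)) : LieSubalgebra K (Matrix n n K)) = sl n K :=
  rfl

/-- The identity map `slIdeal n K ≃ₗ⁅K⁆ sl n K` (same carrier, same bracket). [cite: Humphreys1972, §1.2] -/
def slIdealEquiv : slIdeal n K ≃ₗ⁅K⁆ sl n K where
  toFun X := ⟨X.1, X.2⟩
  map_add' _ _ := rfl
  map_smul' _ _ := rfl
  map_lie' {_ _} := rfl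
  invFun X := ⟨X.1, X.2⟩
  left_inv _ := rfl
  right_inv _ := rfl

variable {n K} in
/-- `slIdealEquiv` is the identity on carriers. [cite: Humphreys1972, §1.2] -/
@[simp] theorem coe_slIdealEquiv (X : slIdeal n K) : ((slIdealEquiv n K X : sl n K) : Matrix n n K) = X := rfl

variable {n K} in
/-- `slIdealEquiv.symm` is the identity on carriers. [cite: Humphreys1972, §1.2] -/
@[simp] theorem coe_slIdealEquiv_symm (X : sl n K) :
    (((slIdealEquiv n K).symm X : slIdeal n K) : Matrix n n K) = X := rfl

end CommRing

/-! ### The Killing form of `𝔰𝔩_n`: `κ(X, Y) = 2·|n|·Tr(XY)` -/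

section Field

variable [Field K]

variable {n K} in
/-- **Killing form of `𝔰𝔩_n`, ideal packaging**: `κ_{𝔰𝔩_n}(X, Y) = κ_{𝔤𝔩_n}(X, Y) = 2·|n|·Tr(XY)` for traceless `X, Y`
(Humphreys' Lemma §5.1: the Killing form of an ideal is the restriction of the ambient Killing form — Mathlib
`LieIdeal.killingForm_eq` — and the `𝔤𝔩_n` value `2|n|Tr(XY) − 2 Tr X Tr Y` of the tree's `ColourTrace.killingForm_matrix`).
[cite: Humphreys1972, §5.1 Lemma, §6 Exercise 7] -/
theorem killingForm_slIdeal (X Y : slIdeal n K) :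
    killingForm K (slIdeal n K) X Y = 2 * Fintype.card n * ((X : Matrix n n K) * Y).trace := by
  -- Humphreys' Lemma (Mathlib `LieIdeal.killingForm_eq`): `κ_I = κ|_{I×I}`; the restricted form evaluates as the
  -- ambient one on the carriers (definitionally).
  have h : killingForm K (slIdeal n K) X Y = killingForm K (Matrix n n K) (X : Matrix n n K) (Y : Matrix n n K) :=
    LinearMap.congr_fun₂ (LieIdeal.killingForm_eq (R := K) (L := Matrix n n K) (slIdeal n K)) X Y
  have hX : (X : Matrix n n K).trace = 0 := X.2
  rw [h, killingForm_matrix, hX]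
  ring

variable {n K} in
/-- **THE KILLING FORM OF `𝔰𝔩(n, K)`** (Mathlib's `LieAlgebra.SpecialLinear.sl`): `κ(X, Y) = 2·|n|·Tr(XY)`.
[cite: Humphreys1972, §6 Exercise 7] -/
theorem killingForm_sl (X Y : sl n K) :
    killingForm K (sl n K) X Y = 2 * Fintype.card n * ((X : Matrix n n K) * Y).trace := by
  rw [← killingForm_of_equiv_apply (slIdealEquiv n K).symm, killingForm_slIdeal]
  rfl

variable {n K} in
/-- The test-matrix computation behind non-degeneracy: a traceless `X` with `Tr(YX) = 0` for every traceless `Y`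
vanishes, provided `|n| ≠ 0` in `K` (test with `Y = E_{ji}`, `i ≠ j`, giving `X_{ij} = 0`, and `Y = E_{ii} − E_{jj}`,
giving `X_{ii} = X_{jj}`; then `Tr X = |n|·X_{ii} = 0`). [cite: Hall2015, Example 7.3] -/
theorem eq_zero_of_forall_trace_mul_eq_zero {X : Matrix n n K} (hX : X.trace = 0)
    (hn : (Fintype.card n : K) ≠ 0) (h : ∀ Y : Matrix n n K, Y.trace = 0 → (Y * X).trace = 0) : X = 0 := by
  have hoff : ∀ i j, i ≠ j → X i j = 0 := fun i j hij => by
    have := h (single j i 1) (Matrix.trace_single_eq_of_ne j i 1 (Ne.symm hij))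
    simpa [Matrix.trace_single_mul] using this
  have hdiag : ∀ i j, X i i = X j j := fun i j => by
    by_cases hij : i = j
    · rw [hij]
    have := h (single i i 1 - single j j 1) (by simp [Matrix.trace_sub])
    rw [Matrix.sub_mul, Matrix.trace_sub, Matrix.trace_single_mul, Matrix.trace_single_mul] at this
    simpa [sub_eq_zero] using this
  ext i j
  by_cases hij : i = j
  · subst hij
    have htr : X.trace = Fintype.card n * X i i := by
      rw [Matrix.trace]
      simp_rw [Matrix.diag_apply]
      rw [Finset.sum_congr rfl fun k _ => hdiag k i, Finset.sum_const, Finset.card_univ, nsmul_eq_mul]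
    rw [hX] at htr
    have := (mul_eq_zero.1 htr.symm).resolve_left hn
    simpa using this
  · simpa using hoff i j hij

variable {n K} in
/-- The Killing form of `𝔰𝔩_n` has trivial kernel when `2 ≠ 0` and `|n| ≠ 0` in `K`.
[cite: Humphreys1972, §5.1, §6 Exercise 7] -/
theorem killingForm_sl_eq_zero_imp (h2 : (2 : K) ≠ 0) (hn : (Fintype.card n : K) ≠ 0) (X : sl n K)
    (h : ∀ Y : sl n K, killingForm K (sl n K) Y X = 0) : X = 0 := by
  have h2n : (2 * Fintype.card n : K) ≠ 0 := mul_ne_zero h2 hn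
  refine Subtype.ext (eq_zero_of_forall_trace_mul_eq_zero X.2 hn fun Y hY => ?_)
  have := h ⟨Y, hY⟩
  rw [killingForm_sl] at this
  exact (mul_eq_zero.1 this).resolve_left h2n

variable {n K} in
/-- **`𝔰𝔩(n, K)` IS KILLING** (non-degenerate Killing form) whenever `2 ≠ 0` and `|n| ≠ 0` in `K`.
[cite: Humphreys1972, §5.1 Theorem 5.1, §6 Exercise 7] -/
theorem isKilling_sl (h2 : (2 : K) ≠ 0) (hn : (Fintype.card n : K) ≠ 0) : LieAlgebra.IsKilling K (sl n K) := by
  refine ⟨?_⟩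
  rw [eq_bot_iff]
  intro X hX
  rw [LieIdeal.mem_killingCompl] at hX
  rw [LieSubmodule.mem_bot]
  exact killingForm_sl_eq_zero_imp h2 hn X fun Y => hX Y (LieSubmodule.mem_top Y)

/-- `𝔰𝔩(n, K)` is finite-dimensional. [folklore] -/
instance instModuleFiniteSl : Module.Finite K (sl n K) :=
  inferInstanceAs (Module.Finite K (sl n K).toSubmodule)

/-- **`𝔰𝔩(n, K)` is Killing in characteristic zero** (instance; for empty `n` the algebra is trivial).
[cite: Humphreys1972, §5.1 Theorem 5.1, §6 Exercise 7] -/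
instance instIsKillingSl [CharZero K] : LieAlgebra.IsKilling K (sl n K) := by
  cases isEmpty_or_nonempty n with
  | inl _ =>
    refine ⟨?_⟩
    rw [eq_bot_iff]
    intro X _
    rw [LieSubmodule.mem_bot]
    exact Subtype.ext (Matrix.ext fun i _ => isEmptyElim i)
  | inr _ =>
    exact isKilling_sl two_ne_zero (Nat.cast_ne_zero.2 Fintype.card_ne_zero)

/-- **`𝔰𝔩(n, K)` IS SEMISIMPLE in characteristic zero** (instance: Mathlib `LieAlgebra.IsKilling.instSemisimple`,
Humphreys' Theorem 5.1 «L is semisimple if and only if its Killing form is nondegenerate»).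
[cite: Humphreys1972, §4 Exercise 1, §5.1 Theorem 5.1] -/
instance instIsSemisimpleSl [CharZero K] : LieAlgebra.IsSemisimple K (sl n K) := inferInstance

/-- The Killing form of `𝔰𝔩(n, K)` is non-degenerate in characteristic zero. [cite: Humphreys1972, §5.1 Theorem 5.1] -/
theorem killingForm_sl_nondegenerate [CharZero K] : (killingForm K (sl n K)).Nondegenerate :=
  LieAlgebra.IsKilling.killingForm_nondegenerate K (sl n K)

/-- `𝔰𝔩(n, K)` has trivial radical in characteristic zero. [cite: Humphreys1972, §4 Exercise 1] -/
instance instHasTrivialRadicalSl [CharZero K] : LieAlgebra.HasTrivialRadical K (sl n K) := inferInstance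

/-- The centre of `𝔰𝔩(n, K)` is trivial in characteristic zero. [cite: Hall2015, Example 7.3] -/
theorem center_sl_eq_bot [CharZero K] : LieAlgebra.center K (sl n K) = ⊥ :=
  LieAlgebra.center_eq_bot K (sl n K)

/-- The same statements for the ideal packaging `slIdeal n K` (transported along `slIdealEquiv`).
[cite: Humphreys1972, §5.1 Theorem 5.1] -/
instance instIsKillingSlIdeal [CharZero K] : LieAlgebra.IsKilling K (slIdeal n K) :=
  (slIdealEquiv n K).symm.isKilling

/-- `𝔰𝔩(n, K)` is non-zero — indeed non-abelian — as soon as `|n| ≥ 2` (Mathlib `sl_non_abelian`), so the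
instances above are not vacuous. [cite: Humphreys1972, §1.2] -/
theorem sl_nontrivial (h : 1 < Fintype.card n) : Nontrivial (sl n K) := by
  by_contra hc
  rw [not_nontrivial_iff_subsingleton] at hc
  exact sl_non_abelian n K h inferInstance

variable {n K} in
/-- Sharpness: if the characteristic of `K` divides `|n| ≠ 0` then the identity matrix is a non-zero CENTRAL element of
`𝔰𝔩(n, K)` (Humphreys §2 Exercise 3: «𝔰𝔩(n, F) has center 0, unless char F divides n, in which case the center is
𝔰(n, F)»), so the Killing form is degenerate (`κ(Y, 1) = Tr(ad Y ∘ ad 1) = 0`). [cite: Humphreys1972, §2 Exercise 3] -/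
theorem not_isKilling_sl_of_natCast_card_eq_zero [Nonempty n] (hn : (Fintype.card n : K) = 0) :
    ¬ LieAlgebra.IsKilling K (sl n K) := by
  intro hK
  have h1 : (1 : Matrix n n K) ∈ sl n K := by
    rw [mem_sl_iff, Matrix.trace_one, hn]
  set E : sl n K := ⟨1, h1⟩ with hE
  have hE0 : E ≠ 0 := fun h => one_ne_zero (congrArg Subtype.val h)
  have had : LieAlgebra.ad K (sl n K) E = 0 := by
    refine LinearMap.ext fun Y => Subtype.ext ?_
    rw [LieAlgebra.ad_apply, LinearMap.zero_apply, LieSubalgebra.coe_bracket, ZeroMemClass.coe_zero, hE,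
      LieRing.of_associative_ring_bracket, Matrix.one_mul, Matrix.mul_one, sub_self]
  have hker : E ∈ LinearMap.ker (killingForm K (sl n K)) := by
    rw [LinearMap.mem_ker]
    ext Y
    rw [killingForm_apply_apply, had, LinearMap.zero_comp, map_zero, LinearMap.zero_apply]
  rw [LieAlgebra.IsKilling.ker_killingForm_eq_bot] at hker
  exact hE0 hker

end Field

end Literature.Algebra.Lie.SpecialLinearKilling
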